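import Summits.AtomisticToContinuum.Crystallization.Theorems.PalmUnimodularRigidityLayeredLawsSelectHcpRelaxedReferenceTail
import HarnessLib

/-!
# Cell lemmas of the shape-exclusion certificate
(crux `SlackRigidity`, stmt-AtomisticToContinuum-11960, line `ekeland-surgery-parity`, numerics stub
`stub_hcpShapeExclusion` of the reshaped `stub_hcpOptimalCongruent`)

The certificate brackets the tree's shape sums `S₃ = hcpSumS 3 c`, `S₆ = hcpSumS 6 c`
(`…CoarseGrainsPinSums`) monotonically between certified values at rational grid points; the sums for
EVERY layer ratio `c > 0` (summability, antitonicity, positivity, certified lower/upper bounds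
`stub_relaxedReferenceTail` / `hcpSumS_le_cert_gen`) are the tree's
`…PalmUnimodularRigidityLayeredLawsSelectHcpRelaxedReferenceTail`.  This file proves the three CELL
LEMMAS: on a cell `[c_L, c_R]`, `G = S₃²/S₆ ≤ hi₃²/lo₆`, so a rational check `hi₃² < L·lo₆` excludes the
cell (`exclusion_cell`); the reference value `lo₃²/hi₆ ≤ G(c₀)` (`shapeG_ge_of_bounds`); and the crude
ratio bounds on the middle window (`ratio_cell`).  All `[folklore]`.
-/

noncomputable section

namespace Summit.AtomisticToContinuum.Crystallization.Theorems.EkelandSurgeryParityUniq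

open Summit.AtomisticToContinuum.Crystallization.Theorems.ExcessDecayLiouvilleCoarseGrains
open Summit.AtomisticToContinuum.Crystallization.Theorems.PalmUnimodularRigidity.LayeredLawsSelectHcp

/-- `0 < S e c` for every `c > 0`, `e ≥ 3`. [folklore] -/
theorem hcpSumS_pos_gen {e : ℕ} (he : 3 ≤ e) {c : ℝ} (hc : 0 < c) : 0 < hcpSumS e c :=
  lt_of_lt_of_le one_pos (hcpSum_one_le_hcpSumS_gen he hc)

/-- **Exclusion cell.**  If `S₃(c_L) ≤ hi₃`, `lo₆ ≤ S₆(c_R)`, `0 < lo₆` and `hi₃² < L·lo₆`, then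
`S₃(c)²/S₆(c) < L` for every `c ∈ [c_L, c_R]` (both sums are antitone in `c`). [folklore] -/
theorem exclusion_cell {cL cR hi₃ lo₆ L : ℝ} (h0 : 0 < cL)
    (h3 : hcpSumS 3 cL ≤ hi₃) (h6 : lo₆ ≤ hcpSumS 6 cR) (hlo₆ : 0 < lo₆) (hnum : hi₃ ^ 2 < L * lo₆) :
    ∀ c : ℝ, cL ≤ c → c ≤ cR → hcpSumS 3 c ^ 2 / hcpSumS 6 c < L := by
  intro c hcL hcR
  have hc : 0 < c := lt_of_lt_of_le h0 hcL
  have hS3 : hcpSumS 3 c ≤ hi₃ := (hcpSumS_antitone_gen (by norm_num) h0 hcL).trans h3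
  have hS3' : 0 ≤ hcpSumS 3 c := (hcpSumS_pos_gen (by norm_num) hc).le
  have hS6 : lo₆ ≤ hcpSumS 6 c := h6.trans (hcpSumS_antitone_gen (by norm_num) hc hcR)
  have hS6' : 0 < hcpSumS 6 c := lt_of_lt_of_le hlo₆ hS6
  have hL : 0 < L := by
    by_contra hL
    push Not at hL
    nlinarith [sq_nonneg hi₃, mul_nonpos_of_nonpos_of_nonneg hL hlo₆.le]
  rw [div_lt_iff₀ hS6']
  have h1 : hcpSumS 3 c ^ 2 ≤ hi₃ ^ 2 := pow_le_pow_left₀ hS3' hS3 2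
  nlinarith [mul_le_mul_of_nonneg_left hS6 hL.le]

/-- **Reference value.**  `lo₃ ≤ S₃(c₀)`, `S₆(c₀) ≤ hi₆`, `0 ≤ lo₃` give `lo₃²/hi₆ ≤ S₃(c₀)²/S₆(c₀)`. [folklore] -/
theorem shapeG_ge_of_bounds {c₀ lo₃ hi₆ : ℝ} (hc₀ : 0 < c₀)
    (h3 : lo₃ ≤ hcpSumS 3 c₀) (h6 : hcpSumS 6 c₀ ≤ hi₆) (hlo₃ : 0 ≤ lo₃) :
    lo₃ ^ 2 / hi₆ ≤ hcpSumS 3 c₀ ^ 2 / hcpSumS 6 c₀ := by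
  have hS6 : 0 < hcpSumS 6 c₀ := hcpSumS_pos_gen (by norm_num) hc₀
  exact div_le_div₀ (sq_nonneg _) (pow_le_pow_left₀ hlo₃ h3 2) hS6 h6

/-- **Ratio cell** (feasibility bounds on the middle window).  Monotone bracketing of `S₃`, `S₆` on
`[c_L, c_R]` and two rational checks give `S₆ ≤ 2 S₃`, `S₃ ≤ 2 S₆` (and positivity) on the cell. [folklore] -/
theorem ratio_cell {cL cR hi₃ lo₃ hi₆ lo₆ : ℝ} (h0 : 0 < cL)
    (hhi₃ : hcpSumS 3 cL ≤ hi₃) (hlo₃ : lo₃ ≤ hcpSumS 3 cR)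
    (hhi₆ : hcpSumS 6 cL ≤ hi₆) (hlo₆ : lo₆ ≤ hcpSumS 6 cR)
    (n₁ : hi₆ ≤ 2 * lo₃) (n₂ : hi₃ ≤ 2 * lo₆) :
    ∀ c : ℝ, cL ≤ c → c ≤ cR →
      0 < hcpSumS 3 c ∧ 0 < hcpSumS 6 c ∧
        hcpSumS 6 c ≤ 2 * hcpSumS 3 c ∧ hcpSumS 3 c ≤ 2 * hcpSumS 6 c := by
  intro c hcL hcR
  have hc : 0 < c := lt_of_lt_of_le h0 hcL
  have e3 : 3 ≤ 3 := le_rfl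
  have e6 : 3 ≤ 6 := by norm_num
  have hS3hi : hcpSumS 3 c ≤ hi₃ := (hcpSumS_antitone_gen e3 h0 hcL).trans hhi₃
  have hS3lo : lo₃ ≤ hcpSumS 3 c := hlo₃.trans (hcpSumS_antitone_gen e3 hc hcR)
  have hS6hi : hcpSumS 6 c ≤ hi₆ := (hcpSumS_antitone_gen e6 h0 hcL).trans hhi₆
  have hS6lo : lo₆ ≤ hcpSumS 6 c := hlo₆.trans (hcpSumS_antitone_gen e6 hc hcR)
  exact ⟨hcpSumS_pos_gen e3 hc, hcpSumS_pos_gen e6 hc, by linarith, by linarith⟩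

/-- Anchor (registered sub-goal `uniqKit_anchor` of stmt-AtomisticToContinuum-11960): antitonicity of
the shape sums on `(0, ∞)` (the tree's `hcpSumS_antitone_gen`, restated). [folklore] -/
theorem uniqKit_anchor :
    ∀ (e : ℕ), 3 ≤ e → ∀ (c₁ c₂ : ℝ), 0 < c₁ → c₁ ≤ c₂ → hcpSumS e c₂ ≤ hcpSumS e c₁ :=
  fun _ he _ _ h₁ h₁₂ => hcpSumS_antitone_gen he h₁ h₁₂

end Summit.AtomisticToContinuum.Crystallization.Theorems.EkelandSurgeryParityUniq

end
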